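import Summits.CriticalPhenomena.CardyFormulaZ2.Theorems.CardyMeckeFlipMeckeRigidityFarCylinder
import Literature.Dynamics.Ergodic.BirkhoffErgodicTheoremProofs

/-!
# Flip-extremal isometry-invariant laws are translation-ergodic (Birkhoff averages of crossing cylinders)

Route `Summits/CriticalPhenomena/CardyFormulaZ2/Theses/CardyMeckeFlip`, crux `MeckeRigidity`
(item stmt-CriticalPhenomena-14826), line `registered`, stub `stub_crossingUniqueness` (helper).

The hypotheses of the crux that concern the law `P` on the Schramm–Smirnov space `ℋ_ℂ` and its
pivotal kernel family `M` — (E2) isometry invariance, (ADM), (F) flip-fairness at every cutoff,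
(EXT) flip-extremality — already force SPATIAL ERGODICITY: for every translation `v ≠ 0` and every
`[0,1]`-valued cylinder function `F(S) = G {j | Qf j ∈ S}` of finitely many crossing events, the
Birkhoff averages `N⁻¹ Σ_{k<N} F(S + k v)` converge `P`-a.s. to the mean `∫ F dP`
(`ae_tendsto_birkhoffAverage_quadPattern`; registered `∀`-form
`tendsto_birkhoffAverage_quadPattern_of_isFlipExtremal`).  In particular joint crossing
frequencies of translates are deterministic, the first input of any coupling / stationary-uniqueness
argument for the flip dynamics; note that neither exact self-duality (D), nor RSW, nor the
isometry-EQUIVARIANCE of the kernel is used.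

Proof.  `S ↦ v + S` is continuous on `ℋ_ℂ` (subbase check) and measure preserving by (E2);
Birkhoff's pointwise ergodic theorem (Literature `ae_tendsto_birkhoffAverage_condExp`) gives a.s.
convergence to the invariant `F* = E[F | 𝓘]`, a.s. `[0,1]`-valued; its clamp `h` is measurable,
`[0,1]`-valued and strictly shift invariant, and the SHIFTED Birkhoff averages
`A_N F ∘ τ^{k₀}` — cylinder functions of the translates `Qf j − (k + k₀) v`, which escape every
ball — approximate `h` in `L¹(P)` uniformly in the shift (dominated convergence + measure
preservation).  So `h` is far-cylinder approximable and the tail-triviality theorem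
`ae_eq_const_of_farCylinderApprox` ((F) + (EXT)) makes it a.s. constant, `= ∫ F dP`.
-/

noncomputable section

open MeasureTheory Set Metric Filter Topology
open scoped ENNReal NNReal
open Literature.Probability.Percolation Literature.Probability.Percolation.QuadCrossing

namespace Summit.CriticalPhenomena.CardyFormulaZ2.Theorems.CardyMeckeFlip

/-! ### The motion of configurations by a plane isometry is continuous and measure preserving -/

/-- `(g ·)⁻¹' V_U = V_{g⁻¹ U}`. [folklore] -/
theorem preimage_isometry_someCrossed (g : ℂ ≃ᵢ ℂ) (U : Set (Quad (univ : Set ℂ))) :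
    QuadConfig.isometry g ⁻¹' QuadConfig.someCrossed U =
      QuadConfig.someCrossed (Quad.congrHomeomorph g.toHomeomorph ⁻¹' U) := by
  ext S
  simp only [mem_preimage, QuadConfig.someCrossed, mem_setOf_eq, QuadConfig.isometry,
    QuadConfig.mapHomeomorph]
  exact Set.image_inter_nonempty_iff

/-- `(g ·)⁻¹' V^Q = V^{g⁻¹ Q}`. [folklore] -/
theorem preimage_isometry_notCrossed (g : ℂ ≃ᵢ ℂ) (Q : Quad (univ : Set ℂ)) :
    QuadConfig.isometry g ⁻¹' QuadConfig.notCrossed Q =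
      QuadConfig.notCrossed (Q.mapHomeomorph g.toHomeomorph.symm) := by
  ext S
  simp only [mem_preimage, QuadConfig.notCrossed, mem_setOf_eq, QuadConfig.isometry,
    QuadConfig.mem_mapHomeomorph]

/-- **`S ↦ g · S` is continuous** for the Schramm–Smirnov topology (preimages of the subbasic
sets are subbasic). [folklore] -/
theorem continuous_quadConfig_isometry (g : ℂ ≃ᵢ ℂ) :
    Continuous (QuadConfig.isometry g : QuadConfig (univ : Set ℂ) → QuadConfig univ) := by
  refine continuous_generateFrom_iff.mpr ?_
  rintro V (⟨U, hU, rfl⟩ | ⟨Q, rfl⟩)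
  · rw [preimage_isometry_someCrossed]
    exact QuadConfig.isOpen_someCrossed (hU.preimage (Quad.congrHomeomorph g.toHomeomorph).continuous)
  · rw [preimage_isometry_notCrossed]
    exact QuadConfig.isOpen_notCrossed _

/-- (E2) makes every motion `S ↦ g · S` a measure-preserving map of `(ℋ_ℂ, P)`. [folklore] -/
theorem measurePreserving_isometry_of_map_eq {P : Measure (QuadConfig (univ : Set ℂ))}
    (g : ℂ ≃ᵢ ℂ) (hg : Measure.map (QuadConfig.isometry g) P = P) :
    MeasurePreserving (QuadConfig.isometry g) P P :=
  ⟨(continuous_quadConfig_isometry g).measurable, hg⟩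

/-! ### Iterated translations of configurations and quads -/

/-- Membership in an iterated motion: `Q ∈ gᵏ · S ↔ g⁻ᵏ ∘ Q ∈ S`. [folklore] -/
theorem mem_iterate_isometry_iff (g : ℂ ≃ᵢ ℂ) (k : ℕ) (S : QuadConfig (univ : Set ℂ))
    (Q : Quad (univ : Set ℂ)) :
    Q ∈ (QuadConfig.isometry g)^[k] S ↔
      (fun Q : Quad (univ : Set ℂ) => Q.mapHomeomorph g.toHomeomorph.symm)^[k] Q ∈ S := by
  induction k generalizing Q with
  | zero => simp
  | succ k ih =>
    rw [Function.iterate_succ_apply', Function.iterate_succ_apply, ← ih]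
    exact QuadConfig.mem_mapHomeomorph (g := g.toHomeomorph)

/-- The `k`-fold inverse translate of a quad by `v`: pointwise `Q z - k v`. [folklore] -/
theorem iterate_translate_quad_apply (v : ℂ) (k : ℕ) (Q : Quad (univ : Set ℂ)) (z : unitInterval × unitInterval) :
    ((fun Q : Quad (univ : Set ℂ) =>
      Q.mapHomeomorph (IsometryEquiv.addLeft v).toHomeomorph.symm)^[k] Q) z = Q z - k * v := by
  induction k generalizing Q with
  | zero => simp
  | succ k ih =>
    rw [Function.iterate_succ_apply, ih]
    simp only [Quad.mapHomeomorph_apply, IsometryEquiv.coe_toHomeomorph_symm,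
      IsometryEquiv.addLeft_symm, IsometryEquiv.addLeft_apply, Nat.cast_succ]
    ring

/-- **Translated quads escape to infinity**: for `v ≠ 0` and a finite family `Qf`, all
translates `Qf j - k v` with `k ≥ k₀` have carriers outside `B̄(0, r)`, for some `k₀`.
[folklore] -/
theorem exists_forall_disjoint_carrier_iterate_translate {v : ℂ} (hv : v ≠ 0) {m : ℕ}
    (Qf : Fin m → Quad (univ : Set ℂ)) (r : ℝ) :
    ∃ k₀ : ℕ, ∀ k, k₀ ≤ k → ∀ j, Disjoint
      (((fun Q : Quad (univ : Set ℂ) =>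
        Q.mapHomeomorph (IsometryEquiv.addLeft v).toHomeomorph.symm)^[k] (Qf j)).carrier)
      (closedBall (0 : ℂ) r) := by
  -- a common radius for the carriers of the family
  have hbdd : ∃ ρ : ℝ, ∀ j z, ‖Qf j z‖ ≤ ρ := by
    have : ∀ j, ∃ ρ : ℝ, ∀ z, ‖Qf j z‖ ≤ ρ := fun j => by
      obtain ⟨ρ, hρ⟩ := (Qf j).isCompact_carrier.isBounded.subset_closedBall (0 : ℂ)
      exact ⟨ρ, fun z => mem_closedBall_zero_iff.1 (hρ ⟨z, rfl⟩)⟩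
    choose ρ hρ using this
    refine ⟨∑ j, |ρ j|, fun j z => (hρ j z).trans ((le_abs_self _).trans ?_)⟩
    exact Finset.single_le_sum (f := fun j => |ρ j|) (fun _ _ => abs_nonneg _) (Finset.mem_univ j)
  obtain ⟨ρ, hρ⟩ := hbdd
  have hvpos : 0 < ‖v‖ := norm_pos_iff.2 hv
  obtain ⟨k₀, hk₀⟩ := exists_nat_gt ((r + ρ) / ‖v‖)
  refine ⟨k₀, fun k hk j => ?_⟩
  rw [Set.disjoint_left]
  rintro x ⟨z, rfl⟩ hx
  rw [mem_closedBall_zero_iff] at hx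
  have happ := iterate_translate_quad_apply v k (Qf j) z
  -- `‖Q z - k v‖ ≥ k ‖v‖ - ρ > r`
  have hk' : (r + ρ) / ‖v‖ < k := hk₀.trans_le (by exact_mod_cast hk)
  rw [div_lt_iff₀ hvpos] at hk'
  have h1 : ‖(k : ℂ) * v‖ = (k : ℝ) * ‖v‖ := by
    rw [norm_mul, Complex.norm_natCast]
  have h2 : ‖(k : ℂ) * v‖ ≤ ‖Qf j z - k * v‖ + ‖Qf j z‖ := by
    calc ‖(k : ℂ) * v‖ = ‖Qf j z - (Qf j z - k * v)‖ := by rw [sub_sub_cancel]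
      _ ≤ ‖Qf j z‖ + ‖Qf j z - k * v‖ := norm_sub_le _ _
      _ = ‖Qf j z - k * v‖ + ‖Qf j z‖ := add_comm _ _
  have h3 : ‖Qf j z - k * v‖ ≤ r := by
    have : (((fun Q : Quad (univ : Set ℂ) =>
        Q.mapHomeomorph (IsometryEquiv.addLeft v).toHomeomorph.symm)^[k] (Qf j)) z) = Qf j z - k * v :=
      happ
    rw [← this]; exact hx
  have h4 := hρ j z
  linarith

/-! ### Birkhoff averages of cylinder functions along a translation are far cylinder functions -/

/-- **Shifted Birkhoff averages are cylinder functions of translated quads.**  For the translation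
`τ = (v + ·)` acting on `ℋ_ℂ`, the Birkhoff average of the cylinder function
`F(S) = G {j | Qf j ∈ S}` over the window `[k₀, k₀ + N)` is the cylinder function, of the
`N · m` translates `Qf j - (k + k₀) v`, given by averaging `G` over the window. [folklore] -/
theorem birkhoffAverage_iterate_eq_quadPattern (v : ℂ) {m : ℕ} (Qf : Fin m → Quad (univ : Set ℂ))
    (G : Set (Fin m) → ℝ) (N k₀ : ℕ) (S : QuadConfig (univ : Set ℂ)) :
    birkhoffAverage ℝ (QuadConfig.isometry (IsometryEquiv.addLeft v)) (fun S => G {j | Qf j ∈ S}) N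
        ((QuadConfig.isometry (IsometryEquiv.addLeft v))^[k₀] S) =
      (fun B : Set (Fin (N * m)) => (N : ℝ)⁻¹ * ∑ k : Fin N, G {j | finProdFinEquiv (k, j) ∈ B})
        {p | ((fun Q : Quad (univ : Set ℂ) =>
          Q.mapHomeomorph (IsometryEquiv.addLeft v).toHomeomorph.symm)^[(finProdFinEquiv.symm p).1 + k₀]
            (Qf (finProdFinEquiv.symm p).2)) ∈ S} := by
  simp only [birkhoffAverage, birkhoffSum, smul_eq_mul, mem_setOf_eq, Equiv.symm_apply_apply]
  congr 1
  rw [← Fin.sum_univ_eq_sum_range]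
  refine Finset.sum_congr rfl fun k _ => ?_
  congr 1
  ext j
  simp only [mem_setOf_eq]
  rw [← Function.iterate_add_apply, mem_iterate_isometry_iff]

/-- Averages of `[0,1]`-valued functions over a window are `[0,1]`-valued. [folklore] -/
theorem windowAverage_mem_Icc {m : ℕ} (G : Set (Fin m) → ℝ) (hG : ∀ A, 0 ≤ G A ∧ G A ≤ 1) (N : ℕ)
    (B : Set (Fin (N * m))) :
    0 ≤ (N : ℝ)⁻¹ * ∑ k : Fin N, G {j | finProdFinEquiv (k, j) ∈ B} ∧
      (N : ℝ)⁻¹ * ∑ k : Fin N, G {j | finProdFinEquiv (k, j) ∈ B} ≤ 1 := by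
  rcases Nat.eq_zero_or_pos N with rfl | hN
  · simp
  have hNr : (0 : ℝ) < N := by exact_mod_cast hN
  constructor
  · exact mul_nonneg (inv_nonneg.2 hNr.le) (Finset.sum_nonneg fun k _ => (hG _).1)
  · rw [inv_mul_le_iff₀ hNr, mul_one]
    calc ∑ k : Fin N, G {j | finProdFinEquiv (k, j) ∈ B} ≤ ∑ _k : Fin N, (1 : ℝ) :=
          Finset.sum_le_sum fun k _ => (hG _).2
      _ = N := by simp

/-! ### Translation ergodicity of flip-extremal laws on cylinder functions -/

/-- **Flip-extremal isometry-invariant laws are translation-ergodic on cylinder functions.**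
Under (E2), (ADM), (F) at every cutoff and (EXT), for every `v ≠ 0` and every `[0,1]`-valued
cylinder function `F(S) = G {j | Qf j ∈ S}`, the Birkhoff averages of `F` along the translation
`S ↦ v + S` converge `P`-a.s. to the mean `∫ F dP`.  Proof: Birkhoff's theorem gives a.s. and `L¹`
convergence to the invariant function `F* = E[F | 𝓘]`; shifted windows show that `F*` is
approximable in `L¹` by `[0,1]`-valued cylinder functions of far-away translates, so the
far-cylinder constancy theorem ((F) + (EXT)) makes `F*` a.s. constant. [folklore] -/
theorem ae_tendsto_birkhoffAverage_quadPattern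
    {P : Measure (QuadConfig (univ : Set ℂ))} [IsProbabilityMeasure P]
    {M : ℝ → QuadConfig (univ : Set ℂ) → Measure ℂ}
    (hE2 : ∀ g : ℂ ≃ᵢ ℂ, Measure.map (QuadConfig.isometry g) P = P)
    (hADM : IsAdmissibleKernel P M) (hF : ∀ ε : ℝ, 0 < ε → IsFlipFairKernel P (M ε))
    (hEXT : IsFlipExtremal P M) {v : ℂ} (hv : v ≠ 0) {m : ℕ} (Qf : Fin m → Quad (univ : Set ℂ))
    (G : Set (Fin m) → ℝ) (hG : ∀ A, 0 ≤ G A ∧ G A ≤ 1) :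
    ∀ᵐ S ∂P, Tendsto (fun N => birkhoffAverage ℝ (QuadConfig.isometry (IsometryEquiv.addLeft v))
      (fun S => G {j | Qf j ∈ S}) N S) atTop (𝓝 (∫ S, G {j | Qf j ∈ S} ∂P)) := by
  -- the translation, the observable, Birkhoff
  set τ : QuadConfig (univ : Set ℂ) → QuadConfig (univ : Set ℂ) :=
    QuadConfig.isometry (IsometryEquiv.addLeft v) with hτ
  set F : QuadConfig (univ : Set ℂ) → ℝ := fun S => G {j | Qf j ∈ S} with hFdef
  have hτmp : MeasurePreserving τ P P := measurePreserving_isometry_of_map_eq _ (hE2 _)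
  have hFm : Measurable F := measurable_comp_quadPattern Qf G
  have hFbd : ∀ S, 0 ≤ F S ∧ F S ≤ 1 := fun S => hG _
  obtain ⟨hFi, -, -⟩ := integrable_of_mem_Icc P hFm hFbd
  have hbirk := Literature.Dynamics.Ergodic.ae_tendsto_birkhoffAverage_condExp hτmp hFi
  set Fs : QuadConfig (univ : Set ℂ) → ℝ := P[F|MeasurableSpace.invariants τ] with hFs
  -- the invariant limit: strictly invariant, measurable, a.s. in `[0,1]`
  have hFs_m' : Measurable[MeasurableSpace.invariants τ] Fs := stronglyMeasurable_condExp.measurable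
  have hFs_m : Measurable Fs := hFs_m'.mono (MeasurableSpace.invariants_le τ) le_rfl
  have hFs_inv : Fs ∘ τ = Fs := MeasurableSpace.comp_eq_of_measurable_invariants hFs_m'
  have hA_mem : ∀ N S, birkhoffAverage ℝ τ F N S ∈ Icc (0 : ℝ) 1 := by
    intro N S
    have := birkhoffAverage_iterate_eq_quadPattern v Qf G N 0 S
    rw [Function.iterate_zero, id_eq] at this
    rw [hτ, hFdef, this]
    exact windowAverage_mem_Icc G hG N _
  have hFs_mem : ∀ᵐ S ∂P, Fs S ∈ Icc (0 : ℝ) 1 := by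
    filter_upwards [hbirk] with S hS
    exact isClosed_Icc.mem_of_tendsto hS (Eventually.of_forall fun N => hA_mem N S)
  -- the clamped version `h` of `Fs`: measurable, `[0,1]`-valued, `= Fs` a.s., strictly invariant
  set h : QuadConfig (univ : Set ℂ) → ℝ := fun S => max 0 (min 1 (Fs S)) with hhdef
  have hhm : Measurable h := measurable_const.max (measurable_const.min hFs_m)
  have hh : ∀ S, 0 ≤ h S ∧ h S ≤ 1 := fun S =>
    ⟨le_max_left _ _, max_le zero_le_one (min_le_left _ _)⟩
  have hh_ae : h =ᵐ[P] Fs := by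
    filter_upwards [hFs_mem] with S hS
    simp only [hhdef]
    rw [min_eq_right hS.2, max_eq_right hS.1]
  have hh_inv : ∀ k S, h (τ^[k] S) = h S := by
    intro k S
    simp only [hhdef]
    have : Fs (τ^[k] S) = Fs S := by
      induction k generalizing S with
      | zero => rfl
      | succ k ih => rw [Function.iterate_succ_apply', ← ih S]; exact congrFun hFs_inv _
    rw [this]
  -- `L¹` convergence of the Birkhoff averages to `h`
  have hL1 : Tendsto (fun N => ∫ S, |h S - birkhoffAverage ℝ τ F N S| ∂P) atTop (𝓝 0) := by
    have hmeasA : ∀ N, Measurable fun S => birkhoffAverage ℝ τ F N S := fun N =>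
      (Literature.Dynamics.Ergodic.measurable_birkhoffSum hτmp.measurable hFm N).const_smul ((N : ℝ)⁻¹)
    have h0 : ∫ S, |h S - h S| ∂P = 0 := by simp
    rw [← h0]
    refine tendsto_integral_of_dominated_convergence (fun _ => (2 : ℝ))
      (fun N => ((hhm.sub (hmeasA N)).norm).aestronglyMeasurable) (integrable_const 2) ?_ ?_
    · intro N
      filter_upwards with S
      rw [Real.norm_eq_abs, abs_abs, abs_le]
      have := hA_mem N S
      constructor <;> linarith [(hh S).1, (hh S).2, this.1, this.2]
    · filter_upwards [hbirk, hh_ae] with S hS hS'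
      rw [hS']
      have : Tendsto (fun N => Fs S - birkhoffAverage ℝ τ F N S) atTop (𝓝 (Fs S - Fs S)) :=
        tendsto_const_nhds.sub hS
      simpa using this.abs
  -- far-cylinder approximability of `h`
  have happrox : ∀ (r : ℕ) (δ : ℝ), 0 < δ → ∃ (m' : ℕ) (Qf' : Fin m' → Quad (univ : Set ℂ))
      (G' : Set (Fin m') → ℝ), (∀ A, 0 ≤ G' A ∧ G' A ≤ 1) ∧
        (∀ j, Disjoint (Qf' j).carrier (Metric.closedBall (0 : ℂ) r)) ∧
          ∫ S, |h S - G' {j | Qf' j ∈ S}| ∂P ≤ δ := by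
    intro r δ hδ
    -- a good window length `N`
    obtain ⟨N, hN⟩ := (Metric.tendsto_atTop.1 hL1 δ hδ)
    have hNδ : ∫ S, |h S - birkhoffAverage ℝ τ F N S| ∂P ≤ δ := by
      have := hN N le_rfl
      rw [Real.dist_eq, sub_zero, abs_of_nonneg (integral_nonneg fun S => abs_nonneg _)] at this
      exact this.le
    -- a shift `k₀` pushing every translate of the window off the ball
    obtain ⟨k₀, hk₀⟩ := exists_forall_disjoint_carrier_iterate_translate hv Qf r
    refine ⟨N * m, fun p => ((fun Q : Quad (univ : Set ℂ) =>
        Q.mapHomeomorph (IsometryEquiv.addLeft v).toHomeomorph.symm)^[(finProdFinEquiv.symm p).1 + k₀]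
          (Qf (finProdFinEquiv.symm p).2)),
      fun B => (N : ℝ)⁻¹ * ∑ k : Fin N, G {j | finProdFinEquiv (k, j) ∈ B},
      fun B => windowAverage_mem_Icc G hG N B, fun p => hk₀ _ (Nat.le_add_left _ _) _, ?_⟩
    -- the approximant is the shifted Birkhoff average; shift invariance of `h` and of `P`
    have hshift : ∀ S, (fun B : Set (Fin (N * m)) => (N : ℝ)⁻¹ * ∑ k : Fin N, G {j | finProdFinEquiv (k, j) ∈ B})
        {p | ((fun Q : Quad (univ : Set ℂ) =>
          Q.mapHomeomorph (IsometryEquiv.addLeft v).toHomeomorph.symm)^[(finProdFinEquiv.symm p).1 + k₀]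
            (Qf (finProdFinEquiv.symm p).2)) ∈ S} = birkhoffAverage ℝ τ F N (τ^[k₀] S) :=
      fun S => (birkhoffAverage_iterate_eq_quadPattern v Qf G N k₀ S).symm
    simp_rw [hshift]
    have hmp := hτmp.iterate k₀
    have hmeasA : Measurable fun S => birkhoffAverage ℝ τ F N S :=
      (Literature.Dynamics.Ergodic.measurable_birkhoffSum hτmp.measurable hFm N).const_smul ((N : ℝ)⁻¹)
    have hmeas' : AEStronglyMeasurable (fun S => |h S - birkhoffAverage ℝ τ F N S|)
        (Measure.map (τ^[k₀]) P) := by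
      rw [hmp.map_eq]
      exact ((hhm.sub hmeasA).norm).aestronglyMeasurable
    have hcomp := integral_map hmp.measurable.aemeasurable hmeas'
    rw [hmp.map_eq] at hcomp
    have key : ∫ S, |h S - birkhoffAverage ℝ τ F N (τ^[k₀] S)| ∂P =
        ∫ S, |h S - birkhoffAverage ℝ τ F N S| ∂P := by
      rw [hcomp]
      refine integral_congr_ae (ae_of_all _ fun S => ?_)
      simp only [hh_inv k₀ S]
    rw [key]
    exact hNδ
  -- constancy of `h`, identification of the constant, conclusion
  have hconst := ae_eq_const_of_farCylinderApprox hADM hF hEXT hhm hh happrox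
  have hmean : ∫ S, h S ∂P = ∫ S, F S ∂P := by
    rw [integral_congr_ae hh_ae]
    exact integral_condExp (MeasurableSpace.invariants_le τ)
  filter_upwards [hbirk, hh_ae, hconst] with S hS h1 h2
  have : Fs S = ∫ S, F S ∂P := by rw [← h1, h2, hmean]
  rw [this] at hS
  exact hS

/-- **Registered form** (sub-goal `tendsto_birkhoffAverage_quadPattern_of_isFlipExtremal` of item
stmt-CriticalPhenomena-14826): under (E2), (ADM), (F) at every cutoff and (EXT), Birkhoff averages
of `[0,1]`-valued crossing-cylinder functions along any translation `v ≠ 0` converge a.s. to the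
mean. [folklore] -/
theorem tendsto_birkhoffAverage_quadPattern_of_isFlipExtremal : ∀ (P : Measure (QuadConfig (Set.univ : Set ℂ))) (M : ℝ → QuadConfig (Set.univ : Set ℂ) → Measure ℂ), IsProbabilityMeasure P → (∀ g : ℂ ≃ᵢ ℂ, Measure.map (QuadConfig.isometry g) P = P) → IsAdmissibleKernel P M → (∀ ε : ℝ, 0 < ε → IsFlipFairKernel P (M ε)) → IsFlipExtremal P M → ∀ (v : ℂ), v ≠ 0 → ∀ (m : ℕ) (Qf : Fin m → Quad (Set.univ : Set ℂ)) (G : Set (Fin m) → ℝ), (∀ A, 0 ≤ G A ∧ G A ≤ 1) → ∀ᵐ S ∂P, Filter.Tendsto (fun N => birkhoffAverage ℝ (QuadConfig.isometry (IsometryEquiv.addLeft v)) (fun S => G {j | Qf j ∈ S}) N S) Filter.atTop (nhds (∫ S, G {j | Qf j ∈ S} ∂P)) := by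
  intro P M hP hE2 hADM hF hEXT v hv m Qf G hG
  exact ae_tendsto_birkhoffAverage_quadPattern hE2 hADM hF hEXT hv Qf G hG

end Summit.CriticalPhenomena.CardyFormulaZ2.Theorems.CardyMeckeFlip

end
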